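import Summits.AtomisticToContinuum.Crystallization.Theorems.SquareWellLayerCakeGapTwelveToBarlowUniformSpacingSelectionCentre
import Summits.AtomisticToContinuum.Crystallization.Theorems.SquareWellLayerCakeGapTwelveToBarlowUniformSpacingSelectionWindows
import Summits.AtomisticToContinuum.Crystallization.Theorems.GscTwinLoopSurgeryGscHingeGlueFinite

/-!
# `stub_uniformSpacingSelection` (crux `GapTwelveToBarlow`, stmt-AtomisticToContinuum-15807), bridge side, VII:
# (b1) `windows_of_badDensity` — a positive density of bad sites yields bad-layer-rich layered windows

The finite-`N` half of the hull ⇒ a.e. bridge (`uniformSpacingSelection-REPORT.md`): if the density of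
sites of `x N` that are NOT near-uniformly relaxed-matched at `(R, ε, δ)` does not tend to `0` (while the
densities of sites without an all-Good `D`-ball / without a relaxed-matched `(R', ε')`-window do), then
for every count `c` there is `L` such that at every scale `n` and tolerance `ε₁`, frequently in `N`, a
translate of `x N` is two-way `ε₁`-matched on `‖·‖ ≤ n` with a normalised layered set having `≥ c` base
layers in `[−L, L]` bad at precision `δ`, range `⌈2R⌉₊` (hypothesis `hwin` of bridge III).  Constants:
bad density frequently `≥ θ` (`sel_theta_of_not_tendsto`); `L = ⌈30625 c/(4θ)⌉₊`; `J = max n L 1`,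
`r = 4J+1`, `R' = R + n + 5r + 6`, `D = r+1`, `ε' = min (ε₁/2) (ε/2) (1/8)`, `κ = θ/1026`; for `N` large
(`sel_eventually_card_le`) the double counting `sel_exists_centre` (volume `sel_card_ball_ge` `≥ 8J³`,
packing `sel_card_sep_ball_le` `≤ 4096J³`) gives a good centre with `≥ 4θJ³` bad sites in its `r`-ball,
`sel_bad_ball_le` makes them `≥ 4θJ³/W` bad layers of a block of `4r+5` layers (`W(4r+5) ≤ 30625J³`),
`sel_window_of_dense` a window of `2L+1` layers with `≥ c` of them, `sel_recentre` + `sel_bad_shift` the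
normalised re-based window.
-/

noncomputable section

namespace Summit.AtomisticToContinuum.Crystallization.Theorems.SquareWellLayerCakeGapTwelveToBarlow

open scoped BigOperators
open Filter Topology Literature.MathematicalPhysics.StatisticalMechanics
open Summit.AtomisticToContinuum.Crystallization.Theorems.LayeredHull

/-- **(b1) Windows of bad density** (anchor; the statement `windows_of_badDensity` of the report, typed in
`SIGB1_windows_of_badDensity.txt`).  See the module docstring. [folklore] -/
theorem stub_windowsOfBadDensity :
    ∀ x : (N : ℕ) → (Fin N → EuclideanSpace ℝ (Fin 3)),
      (∀ D : ℝ, 0 < D →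
              Filter.Tendsto (fun N : ℕ => (Nat.card {i : Fin N // ¬ (∀ j : Fin N, dist (x N i) (x N j) ≤ D →
                ((∀ j' : Fin N, dist (x N j) (x N j') ≤ 11 / 10 → ∀ k : Fin N, k ≠ j' → (55 : ℝ) / 57 ≤ dist (x N j') (x N k)) ∧
                (Finset.univ.filter fun j' : Fin N => j' ≠ j ∧ dist (x N j) (x N j') ≤ 1).card = 12 ∧
                (Finset.univ.filter fun j' : Fin N => j' ≠ j ∧ dist (x N j) (x N j') ≤ 11 / 10).card ≤ 12))} : ℝ) / N)
                Filter.atTop (nhds 0)) →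
      (∀ R ε : ℝ, 0 < R → 0 < ε → ε < 1 / 4 →
              Filter.Tendsto (fun N : ℕ => (Nat.card {i : Fin N // ¬ (∃ a : ℝ, 47 / 50 ≤ a ∧ a ≤ 1 ∧
                ∃ s : ℤ → ℤ, IsHaggSeq s ∧ ∃ z : ℤ → ℝ,
                  (∀ m : ℤ, 39 / 50 * a ≤ z (m + 1) - z m ∧ z (m + 1) - z m ≤ 17 / 20 * a) ∧
                  ∃ m₀ i₀ j₀ : ℤ, ∃ A : EuclideanSpace ℝ (Fin 3) →ₗᵢ[ℝ] EuclideanSpace ℝ (Fin 3),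
                    (∀ m i' j' : ℤ, dist (layeredPos a s z m i' j') (layeredPos a s z m₀ i₀ j₀) ≤ R →
                      ∃ j : Fin N, dist (x N j) (x N i + A (layeredPos a s z m i' j' - layeredPos a s z m₀ i₀ j₀)) ≤ ε) ∧
                    (∀ j : Fin N, dist (x N j) (x N i) ≤ R → ∃ m i' j' : ℤ,
                      dist (x N j) (x N i + A (layeredPos a s z m i' j' - layeredPos a s z m₀ i₀ j₀)) ≤ ε))} : ℝ) / N)
                Filter.atTop (nhds 0)) →
      ∀ R ε δ : ℝ, 0 < R → 0 < ε → 0 < δ →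
      ¬ Filter.Tendsto (fun N : ℕ => (Nat.card {i : Fin N // ¬ (∃ a : ℝ, 47 / 50 ≤ a ∧ a ≤ 1 ∧
                  ∃ s : ℤ → ℤ, IsHaggSeq s ∧ ∃ z : ℤ → ℝ,
                    (∀ m : ℤ, 39 / 50 * a ≤ z (m + 1) - z m ∧ z (m + 1) - z m ≤ 17 / 20 * a) ∧
                    ∃ m₀ i₀ j₀ : ℤ, ∃ A : EuclideanSpace ℝ (Fin 3) →ₗᵢ[ℝ] EuclideanSpace ℝ (Fin 3),
                      (∃ h : ℝ, ∀ m : ℤ, |(m : ℝ) - m₀| ≤ 2 * R → |z m - z m₀ - ((m : ℝ) - m₀) * h| ≤ δ) ∧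
                      (∀ m i' j' : ℤ, dist (layeredPos a s z m i' j') (layeredPos a s z m₀ i₀ j₀) ≤ R →
                        ∃ j : Fin N, dist (x N j) (x N i + A (layeredPos a s z m i' j' - layeredPos a s z m₀ i₀ j₀)) ≤ ε) ∧
                      (∀ j : Fin N, dist (x N j) (x N i) ≤ R → ∃ m i' j' : ℤ,
                        dist (x N j) (x N i + A (layeredPos a s z m i' j' - layeredPos a s z m₀ i₀ j₀)) ≤ ε))} : ℝ) / N)
                  Filter.atTop (nhds 0) →
    ∀ c : ℕ, ∃ L : ℕ, ∀ (n : ℕ) (ε₁ : ℝ), 0 < ε₁ → ∃ᶠ N in Filter.atTop,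
      ∃ (t : EuclideanSpace ℝ (Fin 3)) (A : EuclideanSpace ℝ (Fin 3) →ₗᵢ[ℝ] EuclideanSpace ℝ (Fin 3))
        (a : ℝ) (s : ℤ → ℤ) (z : ℤ → ℝ),
        47 / 50 ≤ a ∧ a ≤ 1 ∧ IsHaggSeq s ∧
        (∀ m : ℤ, 39 / 50 * a ≤ z (m + 1) - z m ∧ z (m + 1) - z m ≤ 17 / 20 * a) ∧
        (-(17 / 20 * a) ≤ z 0 ∧ z 0 ≤ 0) ∧
        (let S : Set (EuclideanSpace ℝ (Fin 3)) := {p | ∃ m i j : ℤ, p = A (((i : ℝ) • triangularVec₁ a) +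
          ((j : ℝ) • triangularVec₂ a) + ((haggLabel s m : ℝ) • barlowOffset a) + (z m • layerNormal 1))};
          (∀ p ∈ S, ‖p‖ ≤ n → ∃ i : Fin N, dist (x N i + t) p ≤ ε₁) ∧
          (∀ i : Fin N, ‖x N i + t‖ ≤ n → ∃ p ∈ S, dist (x N i + t) p ≤ ε₁)) ∧
        ∃ B : Finset ℤ, B ⊆ Finset.Icc (-(L : ℤ)) L ∧ c ≤ B.card ∧
          ∀ m₀ ∈ B, ¬ ∃ h : ℝ, ∀ m : ℤ, |(m : ℝ) - m₀| ≤ (⌈2 * R⌉₊ : ℕ) →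
            |z m - z m₀ - ((m : ℝ) - m₀) * h| ≤ δ := by
  intro x hG hRM R ε δ hR hε hδ hnot c
  classical
  -- Step 0: the bad density `θ` and the window half-length `L`
  obtain ⟨θ, hθ, hfreq⟩ := sel_theta_of_not_tendsto _ (fun N => by positivity) hnot
  refine ⟨⌈30625 * (c : ℝ) / (4 * θ)⌉₊, fun n ε₁ hε₁ => ?_⟩
  set L : ℕ := ⌈30625 * (c : ℝ) / (4 * θ)⌉₊ with hL
  have hL1 : 30625 * (c : ℝ) ≤ 4 * θ * (L + 1) := by
    have h1 := Nat.le_ceil (30625 * (c : ℝ) / (4 * θ))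
    rw [← hL, div_le_iff₀ (by positivity)] at h1
    nlinarith
  -- parameters
  set J : ℕ := max n (max L 1) with hJ
  have hJn : n ≤ J := le_max_left _ _
  have hJL : L ≤ J := (le_max_left _ _).trans (le_max_right _ _)
  have hJ1 : 1 ≤ J := (le_max_right _ _).trans (le_max_right _ _)
  set r : ℕ := 4 * J + 1 with hr
  have hrR : (r : ℝ) = 4 * J + 1 := by rw [hr]; push_cast; ring
  set R' : ℝ := R + n + 5 * r + 6 with hR'
  set D : ℝ := r + 1 with hD
  set ε' : ℝ := min (ε₁ / 2) (min (ε / 2) (1 / 8)) with hε'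
  have hε'0 : 0 < ε' := lt_min (by positivity) (lt_min (by positivity) (by norm_num))
  have hε'1 : ε' ≤ ε₁ / 2 := min_le_left _ _
  have hε'2 : ε' ≤ ε / 2 := (min_le_right _ _).trans (min_le_left _ _)
  have hε'3 : ε' ≤ 1 / 8 := (min_le_right _ _).trans (min_le_right _ _)
  set κ : ℝ := θ / 1026 with hκ
  have hκ0 : 0 < κ := by positivity
  have hn0 : (0 : ℝ) ≤ n := Nat.cast_nonneg n
  have hr0 : (0 : ℝ) ≤ r := Nat.cast_nonneg r
  -- Step 1: eventually few non-good sites; frequently many bad sites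
  have hevG := sel_eventually_card_le _ (hG D (by positivity)) (half_pos hκ0)
  have hevRM := sel_eventually_card_le _ (hRM R' ε' (by positivity) hε'0 (by linarith only [hε'3]))
    (half_pos hκ0)
  refine (hfreq.and_eventually ((hevG.and hevRM).and (eventually_ge_atTop 1))).mono ?_
  rintro N ⟨hbadN, ⟨hGN, hRMN⟩, hN1⟩
  have hNpos : (0 : ℝ) < N := by exact_mod_cast hN1
  -- Step 2: the finsets of bad and of good sites at this `N`
  set y : Fin N → EuclideanSpace ℝ (Fin 3) := x N with hy
  set Bad : Finset (Fin N) := Finset.univ.filter fun i =>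
    ¬ (∃ a : ℝ, 47 / 50 ≤ a ∧ a ≤ 1 ∧ ∃ s : ℤ → ℤ, IsHaggSeq s ∧ ∃ z : ℤ → ℝ,
          (∀ m : ℤ, 39 / 50 * a ≤ z (m + 1) - z m ∧ z (m + 1) - z m ≤ 17 / 20 * a) ∧
          ∃ m₀ i₀ j₀ : ℤ, ∃ A : EuclideanSpace ℝ (Fin 3) →ₗᵢ[ℝ] EuclideanSpace ℝ (Fin 3),
          (∃ h : ℝ, ∀ m : ℤ, |(m : ℝ) - m₀| ≤ 2 * R → |z m - z m₀ - ((m : ℝ) - m₀) * h| ≤ δ) ∧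
          (∀ m i' j' : ℤ, dist (layeredPos a s z m i' j') (layeredPos a s z m₀ i₀ j₀) ≤ R →
            ∃ j : Fin N, dist (y j) (y i + A (layeredPos a s z m i' j' - layeredPos a s z m₀ i₀ j₀)) ≤ ε) ∧
          (∀ j : Fin N, dist (y j) (y i) ≤ R → ∃ m i' j' : ℤ,
            dist (y j) (y i + A (layeredPos a s z m i' j' - layeredPos a s z m₀ i₀ j₀)) ≤ ε)) with hBad
  set Gd : Finset (Fin N) := Finset.univ.filter fun i =>
    (∀ q : Fin N, dist (y i) (y q) ≤ D →
            ((∀ j' : Fin N, dist (y q) (y j') ≤ 11 / 10 → ∀ k : Fin N, k ≠ j' → (55 : ℝ) / 57 ≤ dist (y j') (y k)) ∧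
            (Finset.univ.filter fun j' : Fin N => j' ≠ q ∧ dist (y q) (y j') ≤ 1).card = 12 ∧
            (Finset.univ.filter fun j' : Fin N => j' ≠ q ∧ dist (y q) (y j') ≤ 11 / 10).card ≤ 12)) ∧
    (∃ a : ℝ, 47 / 50 ≤ a ∧ a ≤ 1 ∧ ∃ s : ℤ → ℤ, IsHaggSeq s ∧ ∃ z : ℤ → ℝ,
          (∀ m : ℤ, 39 / 50 * a ≤ z (m + 1) - z m ∧ z (m + 1) - z m ≤ 17 / 20 * a) ∧
          ∃ m₀ i₀ j₀ : ℤ, ∃ A : EuclideanSpace ℝ (Fin 3) →ₗᵢ[ℝ] EuclideanSpace ℝ (Fin 3),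
          (∀ m i' j' : ℤ, dist (layeredPos a s z m i' j') (layeredPos a s z m₀ i₀ j₀) ≤ R' →
            ∃ j : Fin N, dist (y j) (y i + A (layeredPos a s z m i' j' - layeredPos a s z m₀ i₀ j₀)) ≤ ε') ∧
          (∀ j : Fin N, dist (y j) (y i) ≤ R' → ∃ m i' j' : ℤ,
            dist (y j) (y i + A (layeredPos a s z m i' j' - layeredPos a s z m₀ i₀ j₀)) ≤ ε')) with hGd
  have hBadcard : θ * N ≤ (Bad.card : ℝ) := by
    rw [GscHingeGlue.natCard_subtype_eq_card_filter, le_div_iff₀ hNpos] at hbadN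
    exact hbadN
  have hθ1 : θ ≤ 1 := by
    have h1 : (Bad.card : ℝ) ≤ N := by
      have h := Finset.card_le_univ Bad
      rw [Fintype.card_fin] at h
      exact_mod_cast h
    by_contra hcon
    push Not at hcon
    have := mul_lt_mul_of_pos_right hcon hNpos
    linarith only [this, h1, hBadcard]
  have hGdc : (((Finset.univ \ Gd).card : ℕ) : ℝ) ≤ κ * N := by
    rw [GscHingeGlue.natCard_subtype_eq_card_filter] at hGN hRMN
    have hsub : Finset.univ \ Gd ⊆ (Finset.univ.filter fun i => ¬ (∀ q : Fin N, dist (y i) (y q) ≤ D →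
            ((∀ j' : Fin N, dist (y q) (y j') ≤ 11 / 10 → ∀ k : Fin N, k ≠ j' → (55 : ℝ) / 57 ≤ dist (y j') (y k)) ∧
            (Finset.univ.filter fun j' : Fin N => j' ≠ q ∧ dist (y q) (y j') ≤ 1).card = 12 ∧
            (Finset.univ.filter fun j' : Fin N => j' ≠ q ∧ dist (y q) (y j') ≤ 11 / 10).card ≤ 12))) ∪
        (Finset.univ.filter fun i => ¬ (∃ a : ℝ, 47 / 50 ≤ a ∧ a ≤ 1 ∧ ∃ s : ℤ → ℤ, IsHaggSeq s ∧ ∃ z : ℤ → ℝ,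
          (∀ m : ℤ, 39 / 50 * a ≤ z (m + 1) - z m ∧ z (m + 1) - z m ≤ 17 / 20 * a) ∧
          ∃ m₀ i₀ j₀ : ℤ, ∃ A : EuclideanSpace ℝ (Fin 3) →ₗᵢ[ℝ] EuclideanSpace ℝ (Fin 3),
          (∀ m i' j' : ℤ, dist (layeredPos a s z m i' j') (layeredPos a s z m₀ i₀ j₀) ≤ R' →
            ∃ j : Fin N, dist (y j) (y i + A (layeredPos a s z m i' j' - layeredPos a s z m₀ i₀ j₀)) ≤ ε') ∧
          (∀ j : Fin N, dist (y j) (y i) ≤ R' → ∃ m i' j' : ℤ,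
            dist (y j) (y i + A (layeredPos a s z m i' j' - layeredPos a s z m₀ i₀ j₀)) ≤ ε'))) := by
      intro j hj
      have hj' : j ∉ Gd := (Finset.mem_sdiff.1 hj).2
      rw [Finset.mem_union, Finset.mem_filter, Finset.mem_filter]
      by_cases hA : (∀ q : Fin N, dist (y j) (y q) ≤ D →
            ((∀ j' : Fin N, dist (y q) (y j') ≤ 11 / 10 → ∀ k : Fin N, k ≠ j' → (55 : ℝ) / 57 ≤ dist (y j') (y k)) ∧
            (Finset.univ.filter fun j' : Fin N => j' ≠ q ∧ dist (y q) (y j') ≤ 1).card = 12 ∧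
            (Finset.univ.filter fun j' : Fin N => j' ≠ q ∧ dist (y q) (y j') ≤ 11 / 10).card ≤ 12))
      · right
        exact ⟨Finset.mem_univ _, fun hR2 => hj' (Finset.mem_filter.2 ⟨Finset.mem_univ _, hA, hR2⟩)⟩
      · left
        exact ⟨Finset.mem_univ _, hA⟩
    have h1 := (Finset.card_le_card hsub).trans (Finset.card_union_le _ _)
    have h2 : (((Finset.univ \ Gd).card : ℕ) : ℝ) ≤
        (((Finset.univ.filter fun i => ¬ (∀ q : Fin N, dist (y i) (y q) ≤ D →
            ((∀ j' : Fin N, dist (y q) (y j') ≤ 11 / 10 → ∀ k : Fin N, k ≠ j' → (55 : ℝ) / 57 ≤ dist (y j') (y k)) ∧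
            (Finset.univ.filter fun j' : Fin N => j' ≠ q ∧ dist (y q) (y j') ≤ 1).card = 12 ∧
            (Finset.univ.filter fun j' : Fin N => j' ≠ q ∧ dist (y q) (y j') ≤ 11 / 10).card ≤ 12))).card : ℕ) : ℝ) +
        (((Finset.univ.filter fun i => ¬ (∃ a : ℝ, 47 / 50 ≤ a ∧ a ≤ 1 ∧ ∃ s : ℤ → ℤ, IsHaggSeq s ∧ ∃ z : ℤ → ℝ,
          (∀ m : ℤ, 39 / 50 * a ≤ z (m + 1) - z m ∧ z (m + 1) - z m ≤ 17 / 20 * a) ∧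
          ∃ m₀ i₀ j₀ : ℤ, ∃ A : EuclideanSpace ℝ (Fin 3) →ₗᵢ[ℝ] EuclideanSpace ℝ (Fin 3),
          (∀ m i' j' : ℤ, dist (layeredPos a s z m i' j') (layeredPos a s z m₀ i₀ j₀) ≤ R' →
            ∃ j : Fin N, dist (y j) (y i + A (layeredPos a s z m i' j' - layeredPos a s z m₀ i₀ j₀)) ≤ ε') ∧
          (∀ j : Fin N, dist (y j) (y i) ≤ R' → ∃ m i' j' : ℤ,
            dist (y j) (y i + A (layeredPos a s z m i' j' - layeredPos a s z m₀ i₀ j₀)) ≤ ε'))).card : ℕ) : ℝ) := by exact_mod_cast h1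
    linarith only [h2, hGN, hRMN]
  -- separation of the good sites, volume and packing bounds
  have hGsep : ∀ j ∈ Gd, ∀ k : Fin N, k ≠ j → (55 : ℝ) / 57 ≤ dist (y j) (y k) := by
    intro j hj k hk
    obtain ⟨-, hAG, -⟩ := Finset.mem_filter.1 hj
    exact (hAG j (by rw [dist_self]; positivity)).1 j (by rw [dist_self]; norm_num) k hk
  have hv : ∀ j ∈ Gd, (2 * J + 1) ^ 3 ≤ (Finset.univ.filter fun i' : Fin N => dist (y j) (y i') ≤ r).card := by
    intro j hj
    obtain ⟨-, -, a, ha, ha1, s, hs, z, hz, m₀, i₀, j₀, A, hW1, -⟩ := Finset.mem_filter.1 hj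
    have h1 := sel_card_ball_ge y j ha ha1 hs hz A m₀ i₀ j₀ (by linarith only [hε'3] : ε' < 1 / 4) J
      (by rw [hR']; linarith only [hrR, hR.le, hn0, hr0]) hW1
    refine h1.trans (Finset.card_le_card fun i' hi' => ?_)
    rw [Finset.mem_filter] at hi' ⊢
    refine ⟨hi'.1, ?_⟩
    rw [dist_comm, hrR]
    linarith only [hi'.2]
  have hV : ∀ i' : Fin N, (Gd.filter fun j => dist (y j) (y i') ≤ r).card ≤ (3 * r + 1) ^ 3 := by
    intro i'
    have := sel_card_sep_ball_le y (y i') hr0 Gd hGsep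
    exact_mod_cast this
  have hGdne : Gd.Nonempty := by
    rw [Finset.nonempty_iff_ne_empty]
    intro h0
    have h1 : (((Finset.univ \ Gd).card : ℕ) : ℝ) = N := by
      rw [h0, Finset.sdiff_empty, Finset.card_univ, Fintype.card_fin]
    rw [h1] at hGdc
    have hκ1 : κ ≤ 1 / 2 := by rw [hκ]; linarith only [hθ1]
    have := mul_le_mul_of_nonneg_right hκ1 hNpos.le
    linarith only [hGdc, this, hNpos]
  -- Step 3: the centre
  obtain ⟨i, hiGd, hcount⟩ := sel_exists_centre (fun i' j => dist (y j) (y i') ≤ (r : ℝ)) Bad Gd hGdne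
    ((2 * J + 1) ^ 3) ((3 * r + 1) ^ 3) hv hV
  obtain ⟨-, hAGi, a, ha, ha1, s, hs, z, hz, m₀, i₀, j₀, A, hW1, hW2⟩ := Finset.mem_filter.1 hiGd
  -- Step 4: the bad sites of its ball lie on bad layers
  have hsep : ∀ j : Fin N, dist (y j) (y i) ≤ r + 1 → ∀ k : Fin N, k ≠ j → (55 : ℝ) / 57 ≤ dist (y j) (y k) := by
    intro j hj k hk
    exact (hAGi j (by rw [dist_comm, hD]; exact hj)).1 j (by rw [dist_self]; norm_num) k hk
  obtain ⟨M, hMsub, hMbad, hX⟩ := sel_bad_ball_le y i ha ha1 hs hz A m₀ i₀ j₀ r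
    (by linarith only [hε'3] : ε' < 55 / 114) (by linarith only [hε'2] : 2 * ε' ≤ ε) hR.le
    (by rw [hR']; linarith only [hn0, hr0]) hW1 hW2 hsep
    Bad (fun j hj => (Finset.mem_filter.1 hj).2)
  -- Step 5: sub-block averaging
  have hMsub' : M ⊆ Finset.Icc (m₀ - 2 * (r + 1)) (m₀ - 2 * (r + 1) + ((4 * (r + 1) : ℕ) : ℤ)) := by
    have e : m₀ - 2 * ((r : ℤ) + 1) + ((4 * (r + 1) : ℕ) : ℤ) = m₀ + 2 * (r + 1) := by push_cast; ring
    rw [e]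
    exact hMsub
  obtain ⟨μ, hμ, hwin⟩ := sel_window_of_dense M (m₀ - 2 * (r + 1)) (4 * (r + 1)) L (by omega) hMsub'
  -- Step 6: the arithmetic: at least `c` bad layers in the window
  have hcMw : c ≤ (M.filter fun m => μ - L ≤ m ∧ m ≤ μ + L).card := by
    -- (i) many bad good sites
    have h_i : (θ - κ) * N ≤ (((Bad ∩ Gd).card : ℕ) : ℝ) := by
      have e1 := Finset.card_inter_add_card_sdiff Bad Gd
      have e2 : (Bad \ Gd).card ≤ (Finset.univ \ Gd).card :=
        Finset.card_le_card (Finset.sdiff_subset_sdiff (Finset.subset_univ _) le_rfl)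
      have e3 : (((Bad ∩ Gd).card : ℕ) : ℝ) + (((Finset.univ \ Gd).card : ℕ) : ℝ) ≥ Bad.card := by
        exact_mod_cast (by omega : Bad.card ≤ (Bad ∩ Gd).card + (Finset.univ \ Gd).card)
      linarith only [e3, hBadcard, hGdc]
    -- (ii) the double count, in `ℝ`, divided by `N`
    have h_ii : ((θ - κ) * N) * (((2 * J + 1) ^ 3 : ℕ) : ℝ) ≤
        N * ((((Bad.filter fun j => dist (y j) (y i) ≤ (r : ℝ)).card : ℕ) : ℝ)) +
          κ * N * (((3 * r + 1) ^ 3 : ℕ) : ℝ) := by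
      have hc' : ((((Bad ∩ Gd).card * (2 * J + 1) ^ 3 : ℕ)) : ℝ) ≤
          ((Gd.card * (Bad.filter fun j => dist (y j) (y i) ≤ (r : ℝ)).card +
            (Finset.univ \ Gd).card * (3 * r + 1) ^ 3 : ℕ) : ℝ) := by exact_mod_cast hcount
      push_cast at hc'
      have hGdN : ((Gd.card : ℕ) : ℝ) ≤ N := by
        have h := Finset.card_le_univ Gd
        rw [Fintype.card_fin] at h
        exact_mod_cast h
      have hv0 : (0 : ℝ) ≤ (2 * (J : ℝ) + 1) ^ 3 := by positivity
      have hX0 : (0 : ℝ) ≤ (((Bad.filter fun j => dist (y j) (y i) ≤ (r : ℝ)).card : ℕ) : ℝ) := Nat.cast_nonneg _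
      have hV0 : (0 : ℝ) ≤ (3 * (r : ℝ) + 1) ^ 3 := by positivity
      push_cast
      linarith only [hc', mul_le_mul_of_nonneg_right h_i hv0, mul_le_mul_of_nonneg_right hGdN hX0,
        mul_le_mul_of_nonneg_right hGdc hV0]
    have h_iii : (θ - κ) * (((2 * J + 1) ^ 3 : ℕ) : ℝ) - κ * (((3 * r + 1) ^ 3 : ℕ) : ℝ) ≤
        (((Bad.filter fun j => dist (y j) (y i) ≤ (r : ℝ)).card : ℕ) : ℝ) := by
      by_contra hcon
      push Not at hcon
      have := mul_lt_mul_of_pos_left hcon hNpos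
      linarith only [this, h_ii]
    -- (iii) crude polynomial bounds in `J ≥ 1`
    have hJ1R : (1 : ℝ) ≤ J := by exact_mod_cast hJ1
    have hv8 : (8 : ℝ) * (J : ℝ) ^ 3 ≤ (((2 * J + 1) ^ 3 : ℕ) : ℝ) := by
      push_cast
      rw [show (2 * (J : ℝ) + 1) ^ 3 = 8 * (J : ℝ) ^ 3 + (12 * (J : ℝ) ^ 2 + 6 * J + 1) by ring]
      exact le_add_of_nonneg_right (by positivity)
    have hV4 : (((3 * r + 1) ^ 3 : ℕ) : ℝ) ≤ 4096 * (J : ℝ) ^ 3 := by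
      push_cast
      rw [hrR]
      have : (3 * (4 * (J : ℝ) + 1) + 1) ≤ 16 * J := by linarith only [hJ1R]
      calc (3 * (4 * (J : ℝ) + 1) + 1) ^ 3 ≤ (16 * (J : ℝ)) ^ 3 := pow_le_pow_left₀ (by positivity) this 3
        _ = 4096 * (J : ℝ) ^ 3 := by ring
    have h_iv : 4 * θ * (J : ℝ) ^ 3 ≤ (((Bad.filter fun j => dist (y j) (y i) ≤ (r : ℝ)).card : ℕ) : ℝ) := by
      have hκ' : 1026 * κ = θ := by rw [hκ]; ring
      have hθκ : 0 ≤ θ - κ := by linarith only [hκ', hθ]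
      have h1 := mul_le_mul_of_nonneg_left hv8 hθκ
      have h2 := mul_le_mul_of_nonneg_left hV4 hκ0.le
      have hκJ : 1026 * (κ * (J : ℝ) ^ 3) = θ * (J : ℝ) ^ 3 := by rw [← hκ']; ring
      linarith only [h1, h2, h_iii, hκJ]
    have hWT : ((((8 * (r + 1) + 1) * (4 * (r + 1) + 1)) * (4 * (r + 1) + 1) : ℕ) : ℝ) ≤ 30625 * (J : ℝ) ^ 3 := by
      push_cast
      rw [hrR]
      have h1 : (8 * (4 * (J : ℝ) + 1 + 1) + 1) ≤ 49 * J := by linarith only [hJ1R]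
      have h2 : (4 * (4 * (J : ℝ) + 1 + 1) + 1) ≤ 25 * J := by linarith only [hJ1R]
      have h3 : (0 : ℝ) ≤ 4 * (4 * (J : ℝ) + 1 + 1) + 1 := by positivity
      have h4 : (0 : ℝ) ≤ 8 * (4 * (J : ℝ) + 1 + 1) + 1 := by positivity
      calc (8 * (4 * (J : ℝ) + 1 + 1) + 1) * (4 * (4 * (J : ℝ) + 1 + 1) + 1) * (4 * (4 * (J : ℝ) + 1 + 1) + 1)
          ≤ (49 * J) * (25 * J) * (25 * J) := by gcongr
        _ = 30625 * (J : ℝ) ^ 3 := by ring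
    -- (iv) the chain
    have h_v : (Bad.filter fun j => dist (y j) (y i) ≤ (r : ℝ)).card * (L + 1) ≤
        (4 * (r + 1) + 1) * (M.filter fun m => μ - L ≤ m ∧ m ≤ μ + L).card *
          ((8 * (r + 1) + 1) * (4 * (r + 1) + 1)) :=
      calc (Bad.filter fun j => dist (y j) (y i) ≤ (r : ℝ)).card * (L + 1)
          ≤ (M.card * ((8 * (r + 1) + 1) * (4 * (r + 1) + 1))) * (L + 1) := Nat.mul_le_mul_right _ hX
        _ = (M.card * (L + 1)) * ((8 * (r + 1) + 1) * (4 * (r + 1) + 1)) := by ring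
        _ ≤ ((4 * (r + 1) + 1) * (M.filter fun m => μ - L ≤ m ∧ m ≤ μ + L).card) *
            ((8 * (r + 1) + 1) * (4 * (r + 1) + 1)) := Nat.mul_le_mul_right _ hwin
    have h_vR : ((((Bad.filter fun j => dist (y j) (y i) ≤ (r : ℝ)).card : ℕ) : ℝ)) * ((L : ℝ) + 1) ≤
        ((((8 * (r + 1) + 1) * (4 * (r + 1) + 1)) * (4 * (r + 1) + 1) : ℕ) : ℝ) *
          ((((M.filter fun m => μ - L ≤ m ∧ m ≤ μ + L).card : ℕ) : ℝ)) := by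
      have := h_v
      have h' : ((((Bad.filter fun j => dist (y j) (y i) ≤ (r : ℝ)).card * (L + 1) : ℕ)) : ℝ) ≤
          (((4 * (r + 1) + 1) * (M.filter fun m => μ - L ≤ m ∧ m ≤ μ + L).card *
            ((8 * (r + 1) + 1) * (4 * (r + 1) + 1)) : ℕ) : ℝ) := by exact_mod_cast this
      push_cast at h' ⊢
      linarith only [h']
    have hfinal : 30625 * (c : ℝ) * (J : ℝ) ^ 3 ≤
        30625 * (J : ℝ) ^ 3 * ((((M.filter fun m => μ - L ≤ m ∧ m ≤ μ + L).card : ℕ) : ℝ)) := by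
      have hJ3 : (0 : ℝ) ≤ (J : ℝ) ^ 3 := by positivity
      have hL0 : (0 : ℝ) ≤ (L : ℝ) + 1 := by positivity
      have hMw0 : (0 : ℝ) ≤ (((M.filter fun m => μ - L ≤ m ∧ m ≤ μ + L).card : ℕ) : ℝ) := Nat.cast_nonneg _
      linarith only [mul_le_mul_of_nonneg_right hL1 hJ3, mul_le_mul_of_nonneg_right h_iv hL0,
        mul_le_mul_of_nonneg_right hWT hMw0, h_vR]
    have hJ3pos : (0 : ℝ) < 30625 * (J : ℝ) ^ 3 := by positivity
    have : (c : ℝ) ≤ (((M.filter fun m => μ - L ≤ m ∧ m ≤ μ + L).card : ℕ) : ℝ) := by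
      by_contra hcon
      push Not at hcon
      have := mul_lt_mul_of_pos_left hcon hJ3pos
      linarith only [this, hfinal]
    exact_mod_cast this
  -- Step 7: re-centre at the window
  have hμ' : 2 * |(μ : ℝ) - m₀| + n + 1 ≤ R' := by
    obtain ⟨h1, h2⟩ := Finset.mem_Icc.1 hμ
    have habs : |(μ : ℝ) - m₀| ≤ 2 * (r + 1) := by
      rw [abs_le]
      constructor
      · have : ((m₀ - 2 * (r + 1) : ℤ) : ℝ) ≤ μ := by exact_mod_cast h1
        push_cast at this; linarith only [this]
      · have : (μ : ℝ) ≤ ((m₀ - 2 * (r + 1) + ((4 * (r + 1) : ℕ) : ℤ) : ℤ) : ℝ) := by exact_mod_cast h2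
        push_cast at this; linarith only [this]
    rw [hR']
    linarith only [habs, hR.le, hr0]
  obtain ⟨t, ht1, ht2⟩ := sel_recentre y i ha ha1 hs hz A m₀ i₀ j₀ μ n (by linarith only [hε'3] : ε' ≤ 1 / 2)
    hμ' hW1 hW2
  -- Step 8: the window
  refine ⟨t, A, a, fun k => s (k + μ), fun k => z (k + μ) - z μ, ha, ha1, fun k => hs (k + μ), ?_, ?_, ?_, ?_⟩
  · intro m
    have := hz (m + μ)
    rw [show m + μ + 1 = m + 1 + μ by ring] at this
    constructor <;> linarith only [this.1, this.2]
  · simp only [zero_add, sub_self]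
    constructor <;> linarith only [ha]
  · dsimp only
    exact ext_match_mono (x N) t _ le_rfl (by linarith only [hε'1] : 2 * ε' ≤ ε₁) ⟨ht1, ht2⟩
  · refine ⟨(M.filter fun m => μ - L ≤ m ∧ m ≤ μ + L).image fun m => m - μ, ?_, ?_, ?_⟩
    · intro m' hm'
      obtain ⟨m, hm, rfl⟩ := Finset.mem_image.1 hm'
      obtain ⟨-, h1, h2⟩ := Finset.mem_filter.1 hm
      rw [Finset.mem_Icc]
      constructor <;> omega
    · rw [Finset.card_image_of_injective _ sub_left_injective]
      exact hcMw
    · intro m' hm'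
      obtain ⟨m, hm, rfl⟩ := Finset.mem_image.1 hm'
      obtain ⟨hmM, -, -⟩ := Finset.mem_filter.1 hm
      exact sel_bad_shift (μ := μ) (hMbad m hmM)


end Summit.AtomisticToContinuum.Crystallization.Theorems.SquareWellLayerCakeGapTwelveToBarlow

end
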